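import Summits.RiemannHypothesis.RiemannHypothesis.Theorems.PfPersistenceHalfLineBiasLandau
import Literature.NumberTheory.LFunctions.GeneralizedRH
import HarnessLib

/-!
# LANDAU for the half-line Chebyshev bias — III: the one-sided dictionary and Suzuki's (ii) ⇒ (i)

Cell `pub-rhpf` (mechanism/rigidity campaign; **no RH claims**), CAND SEAT 7 gen 8, CASE-DAG v6 §6
kernel target LANDAU, third statistic `B(x) = Σ_{n≤x} Λ(n) n^{-1/2} log(x/n) − 4√x`
(`= chebyshevHalfLineBias x` for `x > 0`). File 3 of 3: the cell-facing ONE-SIDED DICTIONARY for the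
log-Riesz (triangular-kernel) dilating statistic, read off MV 15.3 for `B` (file 2,
`BiasLandau.false_of_eventually_le`), and — as its `τ = 0` case — the Landau half of
M. Suzuki's RH criterion (arXiv:2411.07436, Thm. 1): **if `chebyshevHalfLineBias x ≤ 0` for all
large `x`, then RH** (`riemannHypothesis_of_chebyshevHalfLineBias_nonpos`; the tree's named fact
`Suzuki2024_thm1` is the `↔`; its other half, RH ⇒ (ii), is obtained in the sibling file
`PfPersistenceHalfLineBiasScrew` from the tree's RH ⇒ `Ψ ≥ 0` for Suzuki's screw function, and
`suzuki2024_thm1_of_forward` reduces the named fact to exactly that half).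

* `re_le_of_hlb_oneSided`: `η B(x) ≤ A x^τ` for all large `x` (`η = ±1`, `τ ≥ 0`) forces
  `Re ρ ≤ 1/2 + τ` for every zero, i.e. `QuasiRiemannHypothesis (1/2 + τ)`;
* `τ = 0`: a one-sided `O(1)` bound on `B` (EITHER side) implies RH; in particular integer- or
  real-sampled eventual `B ≤ 0` ⇒ RH;
* off RH, `B(x) = Ω±(x^δ)` for some `δ > 0` (`exists_hlb_oscillation_of_not_riemannHypothesis`).

Relation to the tree: `IntegerScrewDiscreteLandau.robustLandau` detects RH from `Ψ(t) ≥ −K` for ALL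
`t ≥ 0`, where Suzuki's screw function `Ψ(log x) = −B(x) + ((Γ'/Γ)(1/4) − log π)(log x)/2 + O(1)`
carries an extra `−2.68… log x`; the present dictionary needs only an EVENTUAL one-sided bound at
ANY power scale `x^τ` and returns the matching zero-free half-plane. RH-free, sorry-free.

References: [Suzuki2024] M. Suzuki, *On variants of Chebyshev's conjecture*, Ramanujan J. 68 (2025)
95 = arXiv:2411.07436, Thm. 1; [MontgomeryVaughan2007] Montgomery–Vaughan, §15.1, Thm. 15.3.
-/

noncomputable section

-- the sub-problem path RiemannHypothesis/RiemannHypothesis duplicates a namespace (D-0017)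
set_option linter.dupNamespace false

open Complex Filter Topology Set

namespace Summit.RiemannHypothesis.RiemannHypothesis.Theorems.PfPersistenceHalfLineBiasDictionary

open Literature.NumberTheory.LFunctions
open Summit.RiemannHypothesis.RiemannHypothesis.Theorems.PfPersistenceDilatingLandauWeightedMellin
open Summit.RiemannHypothesis.RiemannHypothesis.Theorems.PfPersistenceHalfLineBiasMellin
open Summit.RiemannHypothesis.RiemannHypothesis.Theorems.PfPersistenceHalfLineBiasLandau

/-! ## §5 The one-sided dictionary for `B` (cell-facing; RH-free) -/

/-- **One-sided power-scale bound on `B` ⇒ zeros confined.** If `η B(x) ≤ A x^τ` for all large `x`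
(`η = ±1`, `τ ≥ 0`), then every zero of `ζ` has `Re ρ ≤ 1/2 + τ`.
[cite: MontgomeryVaughan2007, Thm. 15.3; Suzuki2024, Thm. 1] -/
theorem re_le_of_hlb_oneSided {η A τ : ℝ} (hη : η = 1 ∨ η = -1) (hτ : 0 ≤ τ)
    (hev : ∀ᶠ x in atTop, η * hlb x ≤ A * x ^ τ)
    {ρ : ℂ} (h0 : riemannZeta ρ = 0) : ρ.re ≤ 1 / 2 + τ := by
  refine not_lt.1 fun hlt ↦ ?_
  have hre : 1 / 2 < ρ.re := by linarith
  set s₀ : ℂ := ρ - (1 / 2 : ℝ) with hs₀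
  have hs₀0 : s₀ ≠ 0 := by
    intro h
    have := congrArg Complex.re h
    simp [hs₀] at this
    linarith
  have hn : 0 < ‖s₀‖ := norm_pos_iff.2 hs₀0
  have hinv : 0 < 1 / ‖s₀‖ ^ 2 := by positivity
  set c : ℝ := 1 / ‖s₀‖ ^ 2 / 2 with hcdef
  have hc0 : 0 < c := by positivity
  have hc : c < 1 / ‖s₀‖ ^ 2 := by rw [hcdef]; linarith
  refine BiasLandau.false_of_eventually_le h0 hre hη hc0 hc ?_
  have hε : 0 < ρ.re - 1 / 2 - τ := by linarith
  have ht : Tendsto (fun x : ℝ ↦ x ^ (ρ.re - 1 / 2 - τ)) atTop atTop := tendsto_rpow_atTop hε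
  filter_upwards [hev, ht.eventually_ge_atTop (A / c), eventually_gt_atTop 0] with x h1 h2 hx
  refine h1.trans ?_
  have hA : A ≤ c * x ^ (ρ.re - 1 / 2 - τ) := by rw [mul_comm]; exact (div_le_iff₀ hc0).1 h2
  have hxτ : 0 ≤ x ^ τ := (Real.rpow_pos_of_pos hx τ).le
  calc A * x ^ τ ≤ c * x ^ (ρ.re - 1 / 2 - τ) * x ^ τ := mul_le_mul_of_nonneg_right hA hxτ
    _ = c * x ^ (ρ.re - 1 / 2) := by rw [mul_assoc, ← Real.rpow_add hx, sub_add_cancel]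

/-- **One-sided `x^τ` bound on `B` ⇒ quasi-RH(1/2 + τ)** (`τ ≥ 0`).
[cite: MontgomeryVaughan2007, Thm. 15.3; Suzuki2024, Thm. 1] -/
theorem quasiRiemannHypothesis_of_hlb_oneSided {η A τ : ℝ} (hη : η = 1 ∨ η = -1) (hτ : 0 ≤ τ)
    (hev : ∀ᶠ x in atTop, η * hlb x ≤ A * x ^ τ) : QuasiRiemannHypothesis (1 / 2 + τ) :=
  fun _s hs hσs _h1 ↦ (not_lt.2 (re_le_of_hlb_oneSided hη hτ hev hs)) hσs

/-- **A one-sided `O(1)` bound on `B` ⇒ RH** (either side, `η = ±1`).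
[cite: Suzuki2024, Thm. 1; MontgomeryVaughan2007, Thm. 15.3] -/
theorem riemannHypothesis_of_hlb_oneSided_bdd {η A : ℝ} (hη : η = 1 ∨ η = -1)
    (hev : ∀ᶠ x in atTop, η * hlb x ≤ A) : RiemannHypothesis := by
  have hev' : ∀ᶠ x in atTop, η * hlb x ≤ A * x ^ (0 : ℝ) := by
    filter_upwards [hev] with x hx
    rwa [Real.rpow_zero, mul_one]
  have hq := quasiRiemannHypothesis_of_hlb_oneSided hη le_rfl hev'
  rw [add_zero] at hq
  exact quasiRiemannHypothesis_one_half_iff_holds.1 hq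

/-- **`B(x) ≤ A` for all large `x` ⇒ RH.** [cite: Suzuki2024, Thm. 1] -/
theorem riemannHypothesis_of_hlb_le {A : ℝ} (hev : ∀ᶠ x in atTop, hlb x ≤ A) :
    RiemannHypothesis := by
  refine riemannHypothesis_of_hlb_oneSided_bdd (η := 1) (A := A) (Or.inl rfl) ?_
  filter_upwards [hev] with x hx
  rwa [one_mul]

/-- **`−A ≤ B(x)` for all large `x` ⇒ RH.** [cite: Suzuki2024, Thm. 1; MontgomeryVaughan2007, Thm. 15.3] -/
theorem riemannHypothesis_of_le_hlb {A : ℝ} (hev : ∀ᶠ x in atTop, -A ≤ hlb x) :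
    RiemannHypothesis := by
  refine riemannHypothesis_of_hlb_oneSided_bdd (η := -1) (A := A) (Or.inr rfl) ?_
  filter_upwards [hev] with x hx
  linarith

/-- **Suzuki 2025, Theorem 1, (ii) ⇒ (i), PROVED:** if `chebyshevHalfLineBias x ≤ 0` for all
`x ≥ x₀` (some `x₀`), then the Riemann Hypothesis holds. [cite: Suzuki2024, Thm. 1] -/
theorem riemannHypothesis_of_chebyshevHalfLineBias_nonpos {x₀ : ℝ}
    (h : ∀ x : ℝ, x₀ ≤ x → chebyshevHalfLineBias x ≤ 0) : RiemannHypothesis := by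
  refine riemannHypothesis_of_hlb_le (A := 0) ?_
  filter_upwards [eventually_ge_atTop x₀, eventually_gt_atTop 0] with x hx hx0
  rw [hlb_eq_chebyshevHalfLineBias hx0]
  exact h x hx

/-- The right-to-left half of the named fact `Suzuki2024_thm1`, PROVED. [cite: Suzuki2024, Thm. 1] -/
theorem suzuki2024_thm1_mpr
    (h : ∃ x₀ : ℝ, 2 ≤ x₀ ∧ ∀ x : ℝ, x₀ ≤ x → chebyshevHalfLineBias x ≤ 0) : RiemannHypothesis := by
  obtain ⟨x₀, -, hx₀⟩ := h
  exact riemannHypothesis_of_chebyshevHalfLineBias_nonpos hx₀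

/-- `Suzuki2024_thm1` reduces to its forward half (RH ⇒ eventual `B ≤ 0`, the explicit-formula
side). [cite: Suzuki2024, Thm. 1] -/
theorem suzuki2024_thm1_of_forward
    (h : RiemannHypothesis → ∃ x₀ : ℝ, 2 ≤ x₀ ∧ ∀ x : ℝ, x₀ ≤ x → chebyshevHalfLineBias x ≤ 0) :
    Suzuki2024_thm1 :=
  ⟨h, suzuki2024_thm1_mpr⟩

/-- **Integer sampling suffices:** if `chebyshevHalfLineBias m ≤ 0` for all large INTEGERS `m`, then
RH — between consecutive integers `B` grows by at most `S(m) log(1 + 1/m) ≤ S(m)/m ≤ log 4 + 4`.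
[cite: Suzuki2024, Thm. 1, Cor. 1] -/
theorem riemannHypothesis_of_chebyshevHalfLineBias_nat_nonpos {m₀ : ℕ}
    (h : ∀ m : ℕ, m₀ ≤ m → chebyshevHalfLineBias m ≤ 0) : RiemannHypothesis := by
  refine riemannHypothesis_of_hlb_le (A := Real.log 4 + 4) ?_
  filter_upwards [eventually_ge_atTop ((m₀ : ℝ) + 1), eventually_ge_atTop (1 : ℝ)] with x hx hx1
  have hx0 : 0 < x := by linarith
  obtain ⟨m, hm⟩ : ∃ m : ℕ, ⌊x⌋₊ = m := ⟨_, rfl⟩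
  have hm1 : 1 ≤ m := by rw [← hm]; exact Nat.one_le_iff_ne_zero.2 (Nat.floor_pos.2 hx1).ne'
  have hmR : (1 : ℝ) ≤ m := by exact_mod_cast hm1
  have hm0 : (0 : ℝ) < m := by linarith
  have hmx : (m : ℝ) ≤ x := by rw [← hm]; exact Nat.floor_le hx0.le
  have hxm : x < m + 1 := by rw [← hm]; exact Nat.lt_floor_add_one x
  have hm₀ : m₀ ≤ m := by
    have : (m₀ : ℝ) < (m : ℝ) + 1 := by linarith
    exact_mod_cast Nat.lt_add_one_iff.1 (by exact_mod_cast this)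
  -- `B(m) ≤ 0` at the integer node
  have hBm : hlb m ≤ 0 := by rw [hlb_eq_chebyshevHalfLineBias hm0]; exact h m hm₀
  -- `B(x) − B(m) = S(m)(log x − log m) − 4(√x − √m) ≤ S(m) log(x/m) ≤ S(m)(x/m − 1) ≤ S(m)/m`
  have hSx : wpsi x = wpsi m := by simp only [wpsi, hm, Nat.floor_natCast]
  have hTx : wT ⌊x⌋₊ = wT ⌊(m : ℝ)⌋₊ := by rw [hm, Nat.floor_natCast]
  have hlogle : Real.log x - Real.log m ≤ 1 / m := by
    rw [← Real.log_div hx0.ne' hm0.ne']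
    have h1 : Real.log (x / m) ≤ x / m - 1 := Real.log_le_sub_one_of_pos (by positivity)
    have h2 : x / m - 1 ≤ 1 / m := by
      rw [div_sub_one hm0.ne', div_le_div_iff_of_pos_right hm0]; linarith
    linarith
  have hsqrt : (m : ℝ) ^ (1 / 2 : ℝ) ≤ x ^ (1 / 2 : ℝ) :=
    Real.rpow_le_rpow hm0.le hmx (by norm_num)
  have hS0 : 0 ≤ wpsi m := wpsi_nonneg _
  have hSm : wpsi m ≤ (Real.log 4 + 4) * m := wpsi_le _ hm0.le
  have hdiff : hlb x - hlb m ≤ Real.log 4 + 4 := by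
    have e : hlb x - hlb m = wpsi m * (Real.log x - Real.log m) -
        4 * (x ^ (1 / 2 : ℝ) - (m : ℝ) ^ (1 / 2 : ℝ)) := by
      simp only [hlb, wR, hSx, hTx]; ring
    rw [e]
    have h1 : wpsi m * (Real.log x - Real.log m) ≤ wpsi m * (1 / m) :=
      mul_le_mul_of_nonneg_left hlogle hS0
    have h2 : wpsi m * (1 / m) ≤ Real.log 4 + 4 := by
      rw [mul_one_div, div_le_iff₀ hm0]; exact hSm
    linarith
  linarith

/-- **Off RH, `B` oscillates at a power scale** (both signs): if RH fails there are `δ > 0`, `c > 0`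
with `B(x) ≥ c x^δ` and `B(x) ≤ −c x^δ` on unbounded sets of `x`.
[cite: MontgomeryVaughan2007, Thm. 15.3; Suzuki2024, Thm. 1] -/
theorem exists_hlb_oscillation_of_not_riemannHypothesis (hRH : ¬ RiemannHypothesis) :
    ∃ δ c : ℝ, 0 < δ ∧ 0 < c ∧ (∃ᶠ x in atTop, c * x ^ δ ≤ hlb x) ∧
      ∃ᶠ x in atTop, hlb x ≤ -(c * x ^ δ) := by
  by_contra hno
  refine hRH (quasiRiemannHypothesis_one_half_iff_holds.1 fun s hs hσs _h1 ↦ ?_)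
  set s₀ : ℂ := s - (1 / 2 : ℝ) with hs₀
  have hs₀0 : s₀ ≠ 0 := by
    intro h
    have := congrArg Complex.re h
    simp [hs₀] at this
    linarith
  have hn : 0 < ‖s₀‖ := norm_pos_iff.2 hs₀0
  have hinv : 0 < 1 / ‖s₀‖ ^ 2 := by positivity
  have hw := BiasLandau.frequently_le_hlb_and_hlb_le hs hσs
    (c := 1 / ‖s₀‖ ^ 2 / 2) (by positivity) (by linarith)
  exact hno ⟨s.re - 1 / 2, 1 / ‖s₀‖ ^ 2 / 2, by linarith, by positivity, hw.1, hw.2⟩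

end Summit.RiemannHypothesis.RiemannHypothesis.Theorems.PfPersistenceHalfLineBiasDictionary

end
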